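import Summits.QuantumFields.BalabanUV.Beta.MultiscaleDistanceGraded
import Literature.MathematicalPhysics.QuantumFieldTheory.Balaban1983to89.B13PerturbativeStep

/-!
# Beta / MultiscaleDistanceMetric — THE SCALE-ADAPTED DISTANCE IS A PSEUDO-METRIC (symmetry, triangle inequality), AND ON THE TORUS
# IT IS A `WeightHyp` WEIGHT FOR THE (2.16) MACHINERY (MODEL; O.2 item (ii), bookkeeping)

(K) `MultiscaleDistance` proved of `d_n = sdist` only what node (w2′) needed (`d_n ≥ 0`, `d_n(x,x) = 0`, one-step Lipschitz in the
TARGET).  The consumers of the `wrs`∕`WRS`∕`RowData` currency ([II] (2.16): an4's `B13PerturbativeStep.WeightHyp` — zero diagonal,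
nonnegativity, TRIANGLE inequality) need more.  This module supplies it: `wlen` is additive under concatenation and invariant under
reversal, hence **`sdist_comm`** (no hypothesis) and **`sdist_triangle`** (for `x, y` in one reachability class — across classes the
`inf ∅ = 0` convention breaks it); on the torus (`MultiscaleDistanceGraded.reachable_torus`) both hold unconditionally and
**`weightHyp_sdist_torus`** packages `(κ, d_n)` (read on sites × components) as a `WeightHyp`
(unit `b2b-balaban-beta-d4-p2`, GEN 8, MODEL crew; claim «MULTISCALE-DECAY-MODEL» l.18614; answers d4-p3-g10 C-d4p3-31 INFO-1 «sdist is
target-Lipschitz only (no symmetry∕triangle)»).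

HONEST FRAMING: discharging `BetaPertH` makes Bałaban's UV stability UNCONDITIONAL — NOT the continuum limit, NOT the Clay problem.
HONEST DEPENDENCY (verbatim): «continuum YM on T⁴ ⇐ BetaPertH ∧ nine spine estimates (0/9 proved); BetaPertH ⇐ (D1) ∧ (D4) ∧ CAP+tail;
G-an2-4 gates asym, D1 and NE2/3/4.»  THIS MODULE DISCHARGES NOTHING of `BetaPertH`, asserts NOTHING printed and cites nothing as a fact
(ABSOLUTE RULE): [folklore] graph-metric bookkeeping (Mathlib `SimpleGraph.Walk.append`∕`reverse`).  LOCI (shape only): [B6] =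
`Balaban1984PropagatorsII` (2.46) p. 231 («the infimum is taken over all admissible contours … with end-points y, y′» — symmetric by
construction); [II] = `Balaban1988RG2Cluster` (2.16) p. 15.  No class change on row D4 (critical-path width 0; D4 DISCHARGE NO DATE); NOT
BetaPertH, NOT continuum, NOT Clay, NOT summit progress.
-/

namespace Summit.QuantumFields.BalabanUV.Beta.MultiscaleDistanceMetric

open Finset Function
open Summit.QuantumFields.BalabanUV.Beta.MultiscaleDistance
open Summit.QuantumFields.BalabanUV.Beta.MultiscaleDistanceGraded (reachable_torus)
open Literature.MathematicalPhysics.QuantumFieldTheory.Balaban1983to89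
open Literature.MathematicalPhysics.QuantumFieldTheory.Balaban1983to89.B9Thm37GluePU (bsrc btgt)
open Literature.MathematicalPhysics.QuantumFieldTheory.Balaban1983to89.B13PerturbativeStep (WeightHyp)
open B5TorusCover (UT)

noncomputable section

/-! ## §1 Concatenation and reversal; symmetry and the triangle inequality -/

section Generic

variable {St Bd : Type} (src tgt : Bd → St) (n : St → ℕ)

/-- Weighted length is additive under concatenation of walks. [folklore] -/
theorem wlen_append : ∀ {x y z : St} (p : (bondGraph src tgt).Walk x y) (q : (bondGraph src tgt).Walk y z),
    wlen src tgt n (p.append q) = wlen src tgt n p + wlen src tgt n q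
  | _, _, _, SimpleGraph.Walk.nil, q => by rw [SimpleGraph.Walk.nil_append, wlen_nil, zero_add]
  | _, _, _, SimpleGraph.Walk.cons h p, q => by
      rw [SimpleGraph.Walk.cons_append, wlen_cons, wlen_cons, wlen_append p q, add_assoc]

/-- Weighted length is invariant under reversal (the step length is symmetric). [folklore] -/
theorem wlen_reverse : ∀ {x y : St} (p : (bondGraph src tgt).Walk x y), wlen src tgt n p.reverse = wlen src tgt n p
  | _, _, SimpleGraph.Walk.nil => by rw [SimpleGraph.Walk.reverse_nil]
  | _, _, SimpleGraph.Walk.cons h p => by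
      rw [SimpleGraph.Walk.reverse_cons, wlen_append, wlen_reverse p, wlen_cons, wlen_cons, wlen_nil, add_zero, slen_comm, add_comm]

/-- **`d_n` is symmetric** (no hypothesis: the two walk types are empty together). [cite: Balaban1984PropagatorsII, (2.46) p.231] -/
theorem sdist_comm (x y : St) : sdist src tgt n x y = sdist src tgt n y x := by
  have key : ∀ a b : St, sdist src tgt n a b ≤ sdist src tgt n b a := by
    intro a b
    by_cases hne : Nonempty ((bondGraph src tgt).Walk b a)
    · haveI := hne
      refine le_ciInf fun q => ?_
      rw [← wlen_reverse src tgt n q]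
      exact sdist_le_wlen src tgt n q.reverse
    · have hE : IsEmpty ((bondGraph src tgt).Walk b a) := not_nonempty_iff.mp hne
      have hE' : IsEmpty ((bondGraph src tgt).Walk a b) := ⟨fun q => hne ⟨q.reverse⟩⟩
      rw [sdist, sdist, Real.iInf_of_isEmpty, Real.iInf_of_isEmpty]
  exact le_antisymm (key x y) (key y x)

/-- **The triangle inequality along a reachability class**: `x ~ y` ⟹ `d_n(x, z) ≤ d_n(x, y) + d_n(y, z)` for every `z`.
(Across classes the convention `inf ∅ = 0` breaks it; on the torus every pair is reachable.) [folklore] -/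
theorem sdist_triangle {x y : St} (hxy : (bondGraph src tgt).Reachable x y) (z : St) :
    sdist src tgt n x z ≤ sdist src tgt n x y + sdist src tgt n y z := by
  haveI : Nonempty ((bondGraph src tgt).Walk x y) := hxy
  by_cases hyz : Nonempty ((bondGraph src tgt).Walk y z)
  · haveI := hyz
    have h1 : ∀ p : (bondGraph src tgt).Walk x y, sdist src tgt n x z - sdist src tgt n y z ≤ wlen src tgt n p := by
      intro p
      have h2 : sdist src tgt n x z - wlen src tgt n p ≤ sdist src tgt n y z := by
        refine le_ciInf fun q => ?_
        have := sdist_le_wlen src tgt n (p.append q)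
        rw [wlen_append] at this
        linarith
      linarith
    have h3 : sdist src tgt n x z - sdist src tgt n y z ≤ sdist src tgt n x y := le_ciInf h1
    linarith
  · have hE : IsEmpty ((bondGraph src tgt).Walk x z) :=
      ⟨fun r => hyz ⟨(Classical.choice hxy).reverse.append r⟩⟩
    rw [show sdist src tgt n x z = 0 by rw [sdist, Real.iInf_of_isEmpty]]
    exact add_nonneg (sdist_nonneg src tgt n x y) (sdist_nonneg src tgt n y z)

end Generic

/-! ## §2 On the torus: an unconditional pseudo-metric and a `WeightHyp` weight for the (2.16) machinery -/

section Torus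

variable {d : ℕ} {N : Fin d → ℕ} [∀ i, NeZero (N i)] (n : UT N → ℕ)

/-- On the torus the triangle inequality holds for every triple. [folklore] -/
theorem sdist_triangle_torus (x y z : UT N) :
    sdist bsrc btgt n x z ≤ sdist bsrc btgt n x y + sdist bsrc btgt n y z :=
  sdist_triangle bsrc btgt n (reachable_torus x y) z

/-- **`(κ, d_n)` read on sites × components is a `WeightHyp` weight** (κ ≥ 0; zero diagonal, nonnegativity, triangle inequality) — the
hypothesis structure of an4's `B13PerturbativeStep` (2.16) machinery (`WRS.mul`, `WRS.sub_apply_zero_of_differentiableOn`, …).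
[cite: Balaban1988RG2Cluster, (2.16) p.15] -/
theorem weightHyp_sdist_torus {Cp : Type} {κ : ℝ} (hκ : 0 ≤ κ) :
    WeightHyp κ (fun p q : UT N × Cp => sdist bsrc btgt n p.1 q.1) where
  κ_nonneg := hκ
  zero := fun p => sdist_self bsrc btgt n p.1
  nonneg := fun p q => sdist_nonneg bsrc btgt n p.1 q.1
  tri := fun p q r => sdist_triangle_torus n p.1 q.1 r.1

/-- The same on the sites themselves. [folklore] -/
theorem weightHyp_sdist_torus_site {κ : ℝ} (hκ : 0 ≤ κ) : WeightHyp κ (fun x y : UT N => sdist bsrc btgt n x y) where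
  κ_nonneg := hκ
  zero := fun x => sdist_self bsrc btgt n x
  nonneg := fun x y => sdist_nonneg bsrc btgt n x y
  tri := fun x y z => sdist_triangle_torus n x y z

end Torus

end

end Summit.QuantumFields.BalabanUV.Beta.MultiscaleDistanceMetric
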